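import Summits.KontsevichZagierPeriods.Zeta5Search.TwoTaleOmega.OmegaBmiss

/-!
# (bmiss)@Ω on the whole two-tale LADDER PLANE (fam-tele g6 #4)

HONEST FRAMING: systematic search; no irrationality claim unless certified.  Linear integer arithmetic + one application of the
closure theorem `OmegaBmiss.bmiss_on_Omega` (cert-2 g5: (bmiss) at every point of `Ω` with `d ≥ 0`, hypothesis-free).  No number
moves; these are IDENTITIES between rational forms.

fam-denom's ladder `L(s)`, `s = p′/q` (`RUNGD.md` §0: tale 1 `α = (6q+p′, 5q+p′, 4q+p′, 7q+p′)·n + 1`, `β = (1, qn+1, 2qn+1, (12q+2p′)n+2)`;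
Remark-5 partner `Â = ((15q+2p′)n+2; (5q+p′)n+1, (6q+p′)n+1, (7q+p′)n+1)`, `B̂ = ((7q+p′)n+2; 3qn+1, (11q+2p′)n+2, (12q+2p′)n+2)`;
rung A = L(0): `p′ = 0`, P15 = `(q,p′) = (2,1)`, rung D1 = L(1/3) = `(3,1)`, L(2/5), P59 = L(3/8), P147 = L(7/20)) depends on `(q, p′, n)`
only through `Q = qn`, `P = p′n`, and in Ω-coordinates it is the LINEAR two-parameter family
`Lad Q P = (a,b,e,f,g) = (7Q+P+1, 4Q+P+1, 6Q+P+1, 5Q+P+1, 12Q+2P+2)`.  For ALL integers `Q ≥ 1`, `P ≥ 0` this point lies in `Ω` with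
`d = 7Q + 2P − 1 ≥ 0` (`Lad_Omega`, `Lad_dInt`; no condition `q ≥ p′` is needed), hence (bmiss) — the Whipple-type identity `q = −q̂` AND
the coincidence `p = −p̂` — holds as an IDENTITY at every rung and every level `n ≥ 1` (`bmiss_Lad`), in particular at rung A (`Lad n 0`:
tale data `(6n+1,5n+1,4n+1,7n+1 | 1,n+1,2n+1,12n+2)` = `Denom.TwoTaleR3Forms.aRungA/bRungA`), at P15 (`P15_eq_Lad`) and at D1 (`Pt.D1`,
`D1_eq_Lad`, `D1_tales`, `bmiss_D1`; P1 g12 17:32Z: along the (bmiss) path the tale-2 decay, the common cells and the eventual-coincidence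
file are not needed for a rung's measure bound — the cell keeps them as the (bmiss)-free second derivation).
-/

namespace Summit.KontsevichZagierPeriods.Zeta5Search.TwoTaleOmega

open Literature.NumberTheory.Irrationality.Zudilin2014

/-- The ladder plane in Ω-coordinates: `Lad Q P = (7Q+P+1, 4Q+P+1, 6Q+P+1, 5Q+P+1, 12Q+2P+2)` (`Q = qn`, `P = p′n`). -/
def Pt.Lad (Q P : ℤ) : Pt := ⟨7 * Q + P + 1, 4 * Q + P + 1, 6 * Q + P + 1, 5 * Q + P + 1, 12 * Q + 2 * P + 2⟩

/-- Tale-1 data on the ladder plane: `a = (6Q+P+1, 5Q+P+1, 4Q+P+1, 7Q+P+1)`, `b = (1, Q+1, 2Q+1, 12Q+2P+2)`. -/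
theorem Lad_t1 (Q P : ℤ) : (Pt.Lad Q P).t1a = ![6 * Q + P + 1, 5 * Q + P + 1, 4 * Q + P + 1, 7 * Q + P + 1] ∧
    (Pt.Lad Q P).t1b = ![1, Q + 1, 2 * Q + 1, 12 * Q + 2 * P + 2] := by
  refine ⟨?_, ?_⟩ <;> (ext i; fin_cases i <;> simp [Pt.t1a, Pt.t1b, Pt.Lad] <;> ring)

/-- Tale-2 (Remark-5 partner) data on the ladder plane: `â = (15Q+2P+2; 5Q+P+1, 6Q+P+1, 7Q+P+1)`,
`b̂ = (7Q+P+2; 3Q+1, 11Q+2P+2, 12Q+2P+2)`. -/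
theorem Lad_t2 (Q P : ℤ) : (Pt.Lad Q P).t2a = ![15 * Q + 2 * P + 2, 5 * Q + P + 1, 6 * Q + P + 1, 7 * Q + P + 1] ∧
    (Pt.Lad Q P).t2b = ![7 * Q + P + 2, 3 * Q + 1, 11 * Q + 2 * P + 2, 12 * Q + 2 * P + 2] := by
  refine ⟨?_, ?_⟩ <;> (ext i; fin_cases i <;> simp [Pt.t2a, Pt.t2b, Pt.Lad] <;> ring)

/-- **The ladder plane lies in `Ω`** for all `Q ≥ 1`, `P ≥ 0`. -/
theorem Lad_Omega (Q P : ℤ) (hQ : 1 ≤ Q) (hP : 0 ≤ P) : (Pt.Lad Q P).Omega := by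
  refine ⟨?_, ?_, ?_, ?_, ?_, ?_, ?_, ?_, ?_⟩ <;> simp only [Pt.Lad] <;> omega

/-- `d(Lad Q P) = 7Q + 2P − 1`. -/
theorem Lad_dInt (Q P : ℤ) : (Pt.Lad Q P).dInt = 7 * Q + 2 * P - 1 := by
  simp only [Pt.dInt, Pt.Lad]; ring

/-- **(bmiss) on the whole ladder plane**: for all `Q ≥ 1`, `P ≥ 0`, `formQ a b = −formQT â b̂ ∧ formP a b = −formPT â b̂` at `Lad Q P`
(hypothesis-free, from `OmegaBmiss.bmiss_on_Omega`). -/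
theorem bmiss_Lad (Q P : ℤ) (hQ : 1 ≤ Q) (hP : 0 ≤ P) : (Pt.Lad Q P).Bmiss :=
  bmiss_on_Omega _ (Lad_Omega Q P hQ hP) (by rw [Lad_dInt]; omega)

/-- P15 is the ladder point `(Q, P) = (2n, n)`. -/
theorem P15_eq_Lad (n : ℕ) : Pt.P15 n = Pt.Lad (2 * n) n := by
  simp only [Pt.P15, Pt.Lad, Pt.mk.injEq]; omega

/-- The rung D1 = L(1/3) point in Ω-coordinates `(22n+1, 13n+1, 19n+1, 16n+1, 38n+2)` (fam-denom `D1-DESIGN-NOTE.md` §0). -/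
def Pt.D1 (n : ℕ) : Pt := ⟨22 * n + 1, 13 * n + 1, 19 * n + 1, 16 * n + 1, 38 * n + 2⟩

/-- D1 is the ladder point `(Q, P) = (3n, n)`. -/
theorem D1_eq_Lad (n : ℕ) : Pt.D1 n = Pt.Lad (3 * n) n := by
  simp only [Pt.D1, Pt.Lad, Pt.mk.injEq]; omega

/-- Tale data of D1 = the note's `a = (19,16,13,22)·n+1`, `b = (1,3n+1,6n+1,38n+2)`, `â = (47n+2;16n+1,19n+1,22n+1)`,
`b̂ = (22n+2;9n+1,35n+2,38n+2)`. -/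
theorem D1_tales (n : ℕ) : (Pt.D1 n).t1a = ![19 * (n : ℤ) + 1, 16 * n + 1, 13 * n + 1, 22 * n + 1] ∧
    (Pt.D1 n).t1b = ![1, 3 * (n : ℤ) + 1, 6 * n + 1, 38 * n + 2] ∧
    (Pt.D1 n).t2a = ![47 * (n : ℤ) + 2, 16 * n + 1, 19 * n + 1, 22 * n + 1] ∧
    (Pt.D1 n).t2b = ![22 * (n : ℤ) + 2, 9 * n + 1, 35 * n + 2, 38 * n + 2] := by
  refine ⟨?_, ?_, ?_, ?_⟩ <;> (ext i; fin_cases i <;> simp [Pt.t1a, Pt.t1b, Pt.t2a, Pt.t2b, Pt.D1] <;> ring)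

/-- **(bmiss) at rung D1 = L(1/3) for every `n ≥ 1`** (hypothesis-free): `formQ a b = −formQT â b̂ ∧ formP a b = −formPT â b̂` at the
D1 data of `D1_tales`. -/
theorem bmiss_D1 (n : ℕ) (hn : 1 ≤ n) : (Pt.D1 n).Bmiss := by
  rw [D1_eq_Lad]
  have h1 : (1 : ℤ) ≤ n := by exact_mod_cast hn
  exact bmiss_Lad _ _ (by omega) (by omega)

end Summit.KontsevichZagierPeriods.Zeta5Search.TwoTaleOmega
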